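import Summits.BirchSwinnertonDyer.BirchSwinnertonDyer.Theses.AlignedTransportAtTwo
import Summits.BirchSwinnertonDyer.BirchSwinnertonDyer.Theorems.AlignedTransportAtTwoBSDOfMainConjectureRankOneAtTwoEulerCharAtTwoKerGLemma34
import Summits.BirchSwinnertonDyer.BirchSwinnertonDyer.Theorems.AlignedTransportAtTwoBSDOfMainConjectureRankOneAtTwoDisegniTight
import Summits.BirchSwinnertonDyer.BirchSwinnertonDyer.Theorems.AlignedTransportAtTwoBSDOfMainConjectureRankOneAtTwoEulerCharAtTwoCellIndex
import Summits.BirchSwinnertonDyer.BirchSwinnertonDyer.Theorems.AlignedTransportAtTwoBSDOfMainConjectureRankOneAtTwoSigmaSqTwoExistence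
import Literature.NumberTheory.DiophantineGeometry.LocalReductionFiniteBadPlacesProofs
import HarnessLib

/-! # Line `birth` — v9 PROPOSAL (attach seat `bsd-line-att-p3` g13 for the C3′ lead lineage `bsd-line-att-p1`; NOT registered — the lead's call)
crux `Summit.BirchSwinnertonDyer.BirchSwinnertonDyer.Theses.AlignedTransportAtTwo.BSDOfMainConjectureRankOneAtTwo` (stmt-BirchSwinnertonDyer-23008).

**v9 = att-p3 g12's v8 with its PRINT stub for Greenberg's Lemma 3.4 DELETED**: the C3′ cell uses Lemma 3.4 only at
`(p, n) = (2, 0)`, where it is a kernel theorem of cell `bsd-2adic` (`GoodOrdTower.natCard_localTowerKerPrimary_zero_eq_sq_two`,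
`Theorems/ByReductionTypeAtTwoEulerCharAtTwoAll.lean`), plugged into the (L) road by att-p3 g13's
`…EulerCharAtTwoKerGLemma34.schneiderLeadingTermFormulaAtTwoSqAt_iff_heightIndexAt_of_prop414` (p660168): per cell curve `W` (good ordinary
at `2`, no rational `2`-torsion) and modulo the ONE named PRINT fact Greenberg Prop. 4.14 (`stub_prop414AtTwo`), the per-curve open stub
`SchneiderLeadingTermFormulaAtTwoSqAt W` is EQUIVALENT to the HEIGHT-INDEX identity (H) `stub_heightIndexAtTwo` read at `W`:
`Finite θ.ker ∧ #coker θ = 1 ∧ #ker θ · (log₂5)^{rank E(ℚ)} = u · Reg₂(Dh) · i_S`, `i_S = (∏_{v∈S} #𝒦_{v,0}[2^∞]) / #(A₀/Sel₀) = [E(ℚ) : E_𝒦]`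
the Cassels–Poitou–Tate index (`…KerGCell.exists_level_kerIndexL_rat`). (H) is «the Bockstein pairing of the derived Kummer map `θ` IS the
canonical `Σ²` height up to a `2`-adic unit, with universal-norm index `[E(ℚ):E_𝒦]`» (Perrin-Riou 1992 §3.4 / Schneider 1985 §§6–8 for odd `p`;
not in print at `2`). Stub set: M, GZK, Σ² (CLOSED), Disegni, Prop414 (PRINT) + ONE open statement (H) — 6 ≤ stubs_max; NO local PRINT input at `2`
is left (Lemma 3.3 value and Lemma 3.4 layer `0` are tree theorems). Composition concludes the crux BY NAME.
HONEST FRAMING: BSD is not proved; C3′ stays OPEN modulo exactly ONE statement not in print at `2` and four published facts; every open/PRINT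
`stub_*` is `sorry`. Nothing here is registered; `Lines/birth.lean` v6 remains the skeleton of record until the lead decides. -/

set_option linter.dupNamespace false

noncomputable section

open scoped Classical NumberField

namespace Summit.BirchSwinnertonDyer.BirchSwinnertonDyer.Cruxes.BSDOfMainConjectureRankOneAtTwo.Birth

open Summit.BirchSwinnertonDyer.BirchSwinnertonDyer.Theses.AlignedTransportAtTwo
open NumberField IsDedekindDomain
open WeierstrassCurve Literature.NumberTheory.EllipticCurves Literature.NumberTheory.EllipticCurves.ModularForms CongruenceSubgroup
  Literature.NumberTheory.EllipticCurves.Greenberg1999 Literature.NumberTheory.EllipticCurves.IwasawaAlgebra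
  Literature.NumberTheory.EllipticCurves.IwasawaDual
  Summit.BirchSwinnertonDyer.Rank1Residual.F1Sign2 Summit.BirchSwinnertonDyer.BirchSwinnertonDyer.Theorems.Rank1ResidualX1Defs

/-- stub M — PRINT: modularity in the parametrisation currency (`nonempty_modularParametrizationData`, BCDT 2001 Thm A + Edixhoven). -/
theorem stub_modularityAtTwo : nonempty_modularParametrizationData := by
  sorry

/-- stub L0a — PRINT: Gross–Zagier–Kolyvagin (`rank_eq_analyticRank_of_analyticRank_le_one`). [cite: GrossZagier1986] [cite: Kolyvagin1990] -/
theorem stub_gzkAtTwo : rank_eq_analyticRank_of_analyticRank_le_one := by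
  sorry

/-- stub L0b — PRINT, CLOSED (v6): the Mazur–Tate sigma-squared division series at `2`. [cite: MazurTate1991, Thm. 3.1] -/
theorem stub_sigmaSqTwo : mazurTate_sigmaSq_existsUnique_two :=
  Summit.BirchSwinnertonDyer.BirchSwinnertonDyer.Theorems.AlignedTransportAtTwoSigmaSqTwo.mazurTate_sigmaSq_existsUnique_two_holds

/-- stub D — PRINT: Disegni 2020 Thm. 1 (`Disegni2020.padicBSD_goodOrd_rankOne`). [cite: Disegni2020, Thm. 1] -/
theorem stub_disegniAtTwo : Disegni2020.padicBSD_goodOrd_rankOne := by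
  sorry

/-- stub P414 — PRINT: Greenberg Prop. 4.14 / Hachimori–Matsuno Cor. (i) at every `p` (`prop414_noFiniteSubmodule_of_not_dvd_torsionOrder`).
[cite: GreenbergLNM1716, Prop. 4.14] [cite: HachimoriMatsuno2000, Cor. (i)] -/
theorem stub_prop414AtTwo : prop414_noFiniteSubmodule_of_not_dvd_torsionOrder := by
  sorry

/-- stub H — THE ONE OPEN statement at `2` (v8/v9): the HEIGHT-INDEX IDENTITY on the cell — for `W/ℚ` globally minimal, good ordinary at `2`,
`E(ℚ)[2] = 0` and `2 ∤ #E(ℚ)_tors`, every finite `S ⊇ {2} ∪ {bad}`, every cyclotomic datum `(κ, γ)`, every finitely generated `Λ`-torsion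
strict-at-`∞` dual `D`, THE canonical `Σ²` height `Dh` with `Reg₂(Dh) ≠ 0`, `Ш(E/ℚ)(2)` finite, every `e`, `e₀`, `κ_M : M ↪ Sel_{2^∞}(E/ℚ)` with
cokernel of order `#Ш(2)`: the derived Kummer map `θ` has finite kernel, trivial cokernel, and
`#ker θ · (log₂5)^{rank E(ℚ)} = u · Reg₂(Dh) · i_S`, `u ∈ ℤ₂ˣ`, `i_S = (∏_{v∈S} #𝒦_{v,0}[2^∞]) / #(A₀/Sel₀)` (= the Cassels–Poitou–Tate index
`[E(ℚ) : E_𝒦]`, `…KerGCell.exists_level_kerIndexL_rat`). NOT in print at `2` over `ℚ` (Perrin-Riou 1992 §3.4 / Schneider 1985 §§6–8, odd `p`).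
[cite: PerrinRiou1992, §3.4 (p odd; the p = 2 text is ours)] [cite: Schneider1985, §§6–8] -/
theorem stub_heightIndexAtTwo :
    ∀ (W : WeierstrassCurve ℚ) [W.IsElliptic] [W.IsGloballyMinimal],
      IsOrdinaryAt W 2 → (∀ P : W.toAffine.Point, 2 • P = 0 → P = 0) → ¬ 2 ∣ W.torsionOrder →
      ∀ (S : Finset (HeightOneSpectrum (𝓞 ℚ))), (∀ v ∉ S, ((2 : ℕ) : 𝓞 ℚ) ∉ v.asIdeal ∧ W.HasGoodReductionAt v) →
      ∀ (κ : ZpExtension ℚ 2) (γ : Field.absoluteGaloisGroup ℚ),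
        κ.IsCyclotomic → κ.IsTopGenerator γ → IsCyclotomicVariable 2 γ →
      ∀ (D : W.SelmerDualData κ γ) [Module.Finite (IwasawaAlgebra 2) D.X], D.IsTorsion →
      ∀ (Dh : PAdicHeightData W 2), Dh.IsCanonicalSq →
        SchneiderConjecture Dh → Finite (AddCommGroup.primaryComponent W.sha 2) →
      ∀ (e : ↥(W.selmerInfty κ ⊓ W.layerInvariants κ 0) ≃+ ↥(endInvariants (W.conjSelmerInfty κ γ - 1)))
        (e₀ : ↥(W.selmerGroupPInfty 2) ≃+ ↥(W.selmerLayer κ 0))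
        (M : Type) [AddCommGroup M] (kS : M →+ ↥(W.selmerGroupPInfty 2)), Function.Injective kS →
        Nat.card (↥(W.selmerGroupPInfty 2) ⧸ kS.range) = Nat.card (AddCommGroup.primaryComponent W.sha 2) →
      ∀ (θ : M →+ EndCoinvariants (W.conjSelmerInfty κ γ - 1)),
        θ = (W.selmerInftyEulerMap κ γ).comp
          (((e : ↥(W.selmerInfty κ ⊓ W.layerInvariants κ 0) →+ ↥(endInvariants (W.conjSelmerInfty κ γ - 1))).comp (W.sMap κ 0)).comp
            ((e₀ : ↥(W.selmerGroupPInfty 2) →+ ↥(W.selmerLayer κ 0)).comp kS)) →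
        Finite θ.ker ∧ Nat.card (EndCoinvariants (W.conjSelmerInfty κ γ - 1) ⧸ θ.range) = 1 ∧
        ∃ u : ℤ_[2]ˣ,
          (Nat.card θ.ker : ℚ_[2]) * padicLog 2 (cyclotomicGenerator 2) ^ W.mordellWeilRank =
            ((u : ℤ_[2]) : ℚ_[2]) * padicRegulator Dh *
              (((∏ v ∈ S, Nat.card (W.localTowerKerPrimary κ (v.adicCompletion ℚ) 0)) / Nat.card (W.KerG κ 0) : ℕ) : ℚ_[2]) := by
  sorry

/-- Cell glue (proved): «no rational `2`-torsion abscissa» ⇒ `E(ℚ)[2] = 0` (as in v7). -/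
theorem forall_two_nsmul_of_forall_not_hasRationalTwoTorsionX (W : WeierstrassCurve ℚ) [W.IsElliptic]
    (ht : ∀ x : ℚ, ¬ HasRationalTwoTorsionX W x) : ∀ P : W.toAffine.Point, 2 • P = 0 → P = 0 := by
  refine (Summit.BirchSwinnertonDyer.Rank1Residual.X5.O1.irr_two_iff_forall_two_nsmul W).mp ?_
  rw [Summit.BirchSwinnertonDyer.Rank1Residual.X5.O1.irr_two_iff_not_exists_addOrderOf_eq_two]
  rintro ⟨P, hP⟩
  have h2 : (2 : ℕ) • P = 0 := by rw [← hP]; exact addOrderOf_nsmul_eq_zero P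
  have hP0 : P ≠ 0 := by
    rintro rfl
    rw [addOrderOf_zero] at hP
    exact absurd hP (by norm_num)
  rcases P with _ | ⟨x, y, hns⟩
  · exact absurd rfl hP0
  · refine ht x ⟨y, hns.1, ?_⟩
    have hneg : (WeierstrassCurve.Affine.Point.some x y hns : W.toAffine.Point) =
        -WeierstrassCurve.Affine.Point.some x y hns :=
      eq_neg_of_add_eq_zero_left (by rwa [two_nsmul] at h2)
    rw [WeierstrassCurve.Affine.Point.neg_some, WeierstrassCurve.Affine.Point.some.injEq] at hneg
    have hy : y = -y - W.a₁ * x - W.a₃ := hneg.2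
    linear_combination hy

/-- Glue (proved): a finite set `S` of finite places off which `E` has good reduction and `v ∤ p` (the bad places and the places above `p`
are finite). [cite: SilvermanAEC2009, VIII.1 Remark 1.3] -/
theorem exists_finset_awayFrom_good {K : Type} [Field K] [NumberField K] (V : WeierstrassCurve K) [V.IsElliptic] (p : ℕ)
    [Fact p.Prime] : ∃ S : Finset (HeightOneSpectrum (𝓞 K)), ∀ v ∉ S, ((p : ℕ) : 𝓞 K) ∉ v.asIdeal ∧ V.HasGoodReductionAt v := by
  classical
  have h1 : (V.badPlaces (𝓞 K)).Finite := V.finite_badPlaces_holds (𝓞 K)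
  have hp0 : Ideal.span {((p : ℕ) : 𝓞 K)} ≠ ⊥ := by
    rw [Ne, Ideal.span_singleton_eq_bot]
    exact_mod_cast (Fact.out : p.Prime).ne_zero
  have h2 : {v : HeightOneSpectrum (𝓞 K) | ((p : ℕ) : 𝓞 K) ∈ v.asIdeal}.Finite := by
    refine (Ideal.finite_factors hp0).subset fun v hv ↦ ?_
    exact (Ideal.dvd_span_singleton).mpr hv
  refine ⟨(h1.union h2).toFinset, fun v hv ↦ ?_⟩
  rw [Set.Finite.mem_toFinset, Set.mem_union, not_or] at hv
  refine ⟨hv.2, ?_⟩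
  by_contra h
  exact hv.1 h

/-- v5's per-curve stub RECOVERED ON THE CELL from v9's (nothing registered under v5/v6/v7 is lost there): `SchneiderLeadingTermFormulaAtTwoSqAt W`
from (H) + P414 via `…KerGLemma34.schneiderLeadingTermFormulaAtTwoSqAt_iff_heightIndexAt_of_prop414` (Lemma 3.4 at `(2,0)` is a tree theorem). -/
theorem stub_leadingTermFormulaAtTwoAt_of_v9 (W : WeierstrassCurve ℚ) [W.IsElliptic] [W.IsGloballyMinimal] (hord : IsOrdinaryAt W 2)
    (ht : ∀ x : ℚ, ¬ HasRationalTwoTorsionX W x) : SchneiderLeadingTermFormulaAtTwoSqAt W := by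
  have hK := forall_two_nsmul_of_forall_not_hasRationalTwoTorsionX W ht
  have h2 := Summit.BirchSwinnertonDyer.BirchSwinnertonDyer.Theorems.AlignedTransportAtTwoEulerCharAtTwoCellIndex.not_two_dvd_torsionOrder_of_forall_not_hasRationalTwoTorsionX
    W ht
  obtain ⟨S, hS⟩ := exists_finset_awayFrom_good W 2
  exact (Summit.BirchSwinnertonDyer.BirchSwinnertonDyer.Theorems.AlignedTransportAtTwoEulerCharAtTwoKerGLemma34.schneiderLeadingTermFormulaAtTwoSqAt_iff_heightIndexAt_of_prop414
      W stub_prop414AtTwo hK h2 hord S hS).mpr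
    (stub_heightIndexAtTwo W hord hK h2 S hS)

/-- Composition (kernel-checked, closed): the crux BY NAME from the six stubs — per cell curve, (H) + P414 give the leading-term formula at `W`
(`stub_leadingTermFormulaAtTwoAt_of_v9`), and `…DisegniTight.leadingTermFormulaAtTwoAt_iff_bsdp` (Disegni, GZK, modularity, `Σ²`) gives `BSDp W 2`. -/
theorem BSDOfMainConjectureRankOneAtTwo_of : BSDOfMainConjectureRankOneAtTwo := by
  intro W _ _ _hcm hord ht _hsq hr hL hMC
  exact (Summit.BirchSwinnertonDyer.BirchSwinnertonDyer.Theorems.AlignedTransportAtTwoDisegniTight.leadingTermFormulaAtTwoAt_iff_bsdp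
    stub_disegniAtTwo stub_gzkAtTwo stub_modularityAtTwo stub_sigmaSqTwo W hord hr hL hMC).mp
    (stub_leadingTermFormulaAtTwoAt_of_v9 W hord ht hord.1 hord.2)

end Summit.BirchSwinnertonDyer.BirchSwinnertonDyer.Cruxes.BSDOfMainConjectureRankOneAtTwo.Birth

end
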